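import Summits.CriticalPhenomena.SAWScalingLimit.Theses.SAWCutPointCondensation

/-!
# Route `SAWCutPointCondensation`: the assembly frame `Assembly` (stmt-CriticalPhenomena-7354)

Closes the assembly item of route `SAWCutPointCondensation` of the sub-problem `SAWScalingLimit`:

  `Assembly := ScheduleExtraction → BlobLawDichotomy → BlobZeroIsSAW → CutPointWindowLimit →
    CondensationLimit → CondensateCovariance → PenaltyUniversality → SAWScalingLimit`.

Bookkeeping only, no mathematics hidden (the same chain as the route's deciding theorem
`closes`, kernel-checked here against the live route declarations). Fix a Dobrushin domain
`(D; a, b)` and an endpoint approximation. By choice over `g > 0`, `CutPointWindowLimit` gives a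
window family `Q : ℝ → ChordalFamily` (junk `0` for `g ≤ 0`); `CondensationLimit Q` gives the
strong-coupling limit `P` (chordal, two-sided restriction, carried by simple boundary-avoiding
curves, `Q g D → P D` weakly as `g → ∞` on approximable domains); `CondensateCovariance` makes
`P` conformally covariant; the IN-TREE THEOREM
`Literature.Probability.RandomPlanarGeometry.LawlerSchrammWerner2003_holds` ([LSW03] p. 5
result 2) identifies `P D` as the chordal SLE_{8/3} law `preWienerMeasure.map Γ`;
`ScheduleExtraction` (with the `0`-or-probability dichotomy `BlobLawDichotomy` of the inlined
blob-time laws at `t = exp (-g δ^{3/4})`) extracts a diagonal schedule `gs δ → ∞` along which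
the window laws converge to `P D`; `PenaltyUniversality` with `t₁ δ := exp (-(gs δ) δ^{3/4})`
and `t₂ ≡ 0` transfers this to the `t = 0` law, which `BlobZeroIsSAW` rewrites as `SAW.law`
pushed to curves; with `SAW.aemeasurable_curve` this is `ConvergesInLawToSLE (8/3) D`, i.e.
`SAWScalingLimit`. No named fact is a hypothesis; axioms are the standard three.

## References

* G. F. Lawler, O. Schramm, W. Werner, *Conformal restriction: the chordal case*, J. Amer.
  Math. Soc. 16 (2003), p. 5 result 2 [LawlerSchrammWerner2003Restriction].
* G. F. Lawler, O. Schramm, W. Werner, *On the scaling limit of planar self-avoiding walk*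
  (2004), §3.4.2 and Prediction 1 (§4.1) [LawlerSchrammWerner2004SAW].
-/

noncomputable section

open MeasureTheory Filter Topology Set
open Summit.CriticalPhenomena.SAWScalingLimit.Theses.SAWCutPointCondensation

namespace Summit.CriticalPhenomena.SAWScalingLimit.Theorems

/-- **Assembly of route SAWCutPointCondensation** (item stmt-CriticalPhenomena-7354):
`ScheduleExtraction → BlobLawDichotomy → BlobZeroIsSAW → CutPointWindowLimit →
CondensationLimit → CondensateCovariance → PenaltyUniversality → SAWScalingLimit`.
Window family by choice over `g > 0`, strong-coupling limit `P` by condensation, conformal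
covariance of `P`, identification of `P D` as chordal SLE_{8/3} by the in-tree theorem
`LawlerSchrammWerner2003_holds`, a diagonal schedule `gs δ → ∞` by `ScheduleExtraction`
(dichotomy `BlobLawDichotomy`), transfer to the `t = 0` law by `PenaltyUniversality`, and
`BlobZeroIsSAW` + `integral_map` to read it as convergence in law of `SAW.law` pushed to curves.
[cite: LawlerSchrammWerner2003Restriction, p. 5 result 2]
[cite: LawlerSchrammWerner2004SAW, §3.4.2 and Prediction 1 (§4.1)] -/
theorem sawCutPointCondensation_assembly_proof :
    Summit.CriticalPhenomena.SAWScalingLimit.Theses.SAWCutPointCondensation.Assembly := by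
  unfold Summit.CriticalPhenomena.SAWScalingLimit.Theses.SAWCutPointCondensation.Assembly
  intro hSched hDich hZero hW hS hC hU D a b hab
  classical
  -- (W): choose the window family `Q g` for `g > 0` (junk `0` for `g ≤ 0`)
  choose Qf hQf using hW
  let Q : ℝ → Literature.Probability.RandomPlanarGeometry.ChordalFamily :=
    fun g => if hg : 0 < g then Qf g hg else fun _ => 0
  have hQdef : ∀ (g : ℝ) (hg : 0 < g), Q g = Qf g hg := fun g hg => dif_pos hg
  -- (S): the strong-coupling limit `P` of the window family
  obtain ⟨P, hPch, hPres, hPsimp, hPlim⟩ :=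
    hS Q (fun g hg => by rw [hQdef g hg]; exact hQf g hg)
  -- (C): `P` is conformally covariant
  have hPcov : P.IsConformallyCovariant :=
    hC Q P (fun g hg => by rw [hQdef g hg]; exact hQf g hg) hPch hPres hPsimp hPlim
  -- LSW 2003 (in-tree theorem): `P D` is the chordal SLE_{8/3} law
  obtain ⟨Γ, hΓ, hPD⟩ :=
    Literature.Probability.RandomPlanarGeometry.LawlerSchrammWerner2003_holds P hPch hPcov hPres
      hPsimp D
  -- diagonal schedule `gs δ → ∞` along the window laws
  obtain ⟨gs, hgs, hlim⟩ :=
    hSched _ (fun g => Q g D) (P D)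
      (fun g hg => by rw [hQdef g hg]; exact ((hQf g hg).1 D).1)
      (hPch D).1
      (fun g δ => hDich (Real.exp (-(g * δ ^ (3 / 4 : ℝ)))) D.carrier δ (a δ) (b δ))
      (fun g hg f => by rw [hQdef g hg]; exact (hQf g hg).2 D a b hab f)
      (hPlim D a b hab)
  -- (U): the scheduled window law and the SAW law (`t ≡ 0`) are asymptotically equal
  have hIcc : ∀ᶠ δ in 𝓝[>] (0 : ℝ), Real.exp (-(gs δ * δ ^ (3 / 4 : ℝ))) ∈ Set.Icc (0 : ℝ) 1 ∧
      (0 : ℝ) ∈ Set.Icc (0 : ℝ) 1 := by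
    filter_upwards [hgs.eventually_ge_atTop 0, self_mem_nhdsWithin] with δ hg hδ
    have hδ' : (0 : ℝ) < δ := hδ
    exact ⟨⟨(Real.exp_pos _).le, Real.exp_le_one_iff.2
      (neg_nonpos.2 (mul_nonneg hg (Real.rpow_nonneg hδ'.le _)))⟩, le_rfl, zero_le_one⟩
  have hM1 : ∀ M : ℝ, ∀ᶠ δ in 𝓝[>] (0 : ℝ),
      Real.exp (-(gs δ * δ ^ (3 / 4 : ℝ))) ≤ Real.exp (-(M * δ ^ (3 / 4 : ℝ))) := by
    intro M
    filter_upwards [hgs.eventually_ge_atTop M, self_mem_nhdsWithin] with δ hg hδ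
    have hδ' : (0 : ℝ) < δ := hδ
    exact Real.exp_le_exp.2 (neg_le_neg (mul_le_mul_of_nonneg_right hg (Real.rpow_nonneg hδ'.le _)))
  have hM2 : ∀ M : ℝ, ∀ᶠ δ in 𝓝[>] (0 : ℝ), (0 : ℝ) ≤ Real.exp (-(M * δ ^ (3 / 4 : ℝ))) :=
    fun M => Filter.Eventually.of_forall fun δ => (Real.exp_pos _).le
  have hU' := hU D a b hab (fun δ => Real.exp (-(gs δ * δ ^ (3 / 4 : ℝ)))) (fun _ => (0 : ℝ))
    hIcc hM1 hM2
  -- assemble: SAW.law pushed to curves converges to `P D = law of Γ`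
  refine ⟨Γ, hΓ, Filter.Eventually.of_forall fun δ =>
    Literature.Probability.RandomPlanarGeometry.SAW.aemeasurable_curve _ _ _ _, ?_⟩
  intro f
  have h1 := (hlim f).sub (hU' f)
  simp only [sub_sub_cancel, sub_zero] at h1
  rw [hPD, MeasureTheory.integral_map hΓ.aemeasurable f.continuous.aestronglyMeasurable] at h1
  refine Filter.Tendsto.congr (fun δ => ?_) h1
  -- at each mesh: the `t = 0` blob-time law is `SAW.law` pushed to curves
  have hZ := hZero D.carrier δ (a δ) (b δ)
  beta_reduce at hZ
  rw [hZ, MeasureTheory.integral_map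
    (Literature.Probability.RandomPlanarGeometry.SAW.aemeasurable_curve _ _ _ _)
    f.continuous.aestronglyMeasurable]

end Summit.CriticalPhenomena.SAWScalingLimit.Theorems

end
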